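import Summits.BirchSwinnertonDyer.BirchSwinnertonDyer.Theorems.GenusKolyvaginAtTwoCasselsTateLevelPairingTotallyComplex
import Literature.NumberTheory.EllipticCurves.CasselsTateAlternating
import HarnessLib

/-!
# The Cassels–Tate theorem over a TOTALLY COMPLEX number field, UNCONDITIONALLY: `exists_casselsTate_pairing (K := K)`
# for every elliptic curve `E/K`, and the pairing of THE canonical maps is a LEVEL pairing at every prime-power level

Route `GenusKolyvaginAtTwo`, crux `GenusPrimitiveSupplyAtTwo` (stmt-BirchSwinnertonDyer-22136) / `KolyvaginExactAtTwo`
(stmt-BirchSwinnertonDyer-22137), Cassels–Tate block at the EVEN level; seat `bsd-line-gk2-p1` g12 (LEAD, cell `bsd-f1-sign2`),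
`--supports 22136`, helper. THEOREMS ONLY (no definition, no named fact, no `sorry`, no instance).

Composition of seat gk2-p2's conditional assembly over a totally complex field
(`GenusKolyvaginAtTwoCasselsTateLevelPairingTotallyComplex`: `isLevelPairing_ctLevelPairing_canonical_of_isTotallyComplex`,
`exists_casselsTate_pairing_of_isTotallyComplex_of_alt`, both modulo Cassels' alternation `hct_alt` / `halt2` of the general-case
value at the `2`-power levels) with this seat's theorem `Literature.NumberTheory.EllipticCurves.ctGeneralFun_self_eq_zero`
(`CasselsTateAlternating`: `⟨a, a⟩ = 0` at EVERY level, from the Morgan–Smith theta group at `l = 2`).  Hence, for `K` totally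
complex (e.g. the Heegner field of the route) and EVERY elliptic curve `E/K`:

* `isLevelPairing_ctLevelPairing_canonical` — the Cassels–Tate pairing of THE canonical invariant maps on `Ш(E/K)[p^k]` is a LEVEL
  pairing at EVERY prime power `p^k` (`k ≥ 1`), incl. `p = 2` — the input `hB` of the K-frame capstones of crux 22137;
* `exists_isLevelPairing` — existence form for every `E/K` and every prime power (Weil pairing from `exists_weilPairing_holds`);
* **`exists_casselsTate_pairing_of_isTotallyComplex`** — the tree's Cassels–Tate fact `WeierstrassCurve.exists_casselsTate_pairing
  (K := K)` (a pairing on all of `Ш(E/K)` with the level-pairing properties, every `E/K`), UNCONDITIONAL; gk2-p3's SquareAllowance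
  over the Heegner field is thereby unconditional.

Over `ℚ` (route item 19420 `CasselsTatePairingRat`) the one remaining input is `hPTc` with archimedean terms (gk2-p2's real-place
port); the same one-line composition then applies.  BSD is not proved by any of this.

References: [Cassels1962ArithmeticIV]; [MilneADT2006] I §6 Prop. 6.9, Thm. 6.13 (a); [MorganSmith2021CTP] §5 Thm. 5.10;
[SilvermanAEC2009] Thm. X.4.14.
-/

noncomputable section

open scoped Classical

-- the Theorems namespace of this sub repeats the summit name by design (D-0017 nested layout)
set_option linter.dupNamespace false
set_option autoImplicit false

namespace Summit.BirchSwinnertonDyer.BirchSwinnertonDyer.Theorems.GenusExact.CasselsTateTotallyComplex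

open _root_.WeierstrassCurve Field Function NumberField
open Literature.NumberTheory.EllipticCurves
open Literature.NumberTheory.GaloisRepresentations Literature.NumberTheory.GaloisCohomology
open Literature.NumberTheory.GaloisRepresentations.DiscreteGaloisModule (mu MuCarrier)
open Summit.BirchSwinnertonDyer.BirchSwinnertonDyer.Theorems.GenusExact.CasselsTatePTc

section LevelPairing

variable {K : Type} [Field K] [NumberField K] (W : WeierstrassCurve K) [W.IsElliptic] (p k : ℕ) [Fact p.Prime]
variable (e : geomTorsion W ((p ^ k * p ^ k : ℕ) : ℤ) → geomTorsion W ((p ^ k * p ^ k : ℕ) : ℤ) → AlgebraicClosure K)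
  (hμ : ∀ S T, e S T ^ (p ^ k * p ^ k) = 1)
  (hadd₁ : ∀ S₁ S₂ T, e (S₁ + S₂) T = e S₁ T * e S₂ T)
  (hadd₂ : ∀ S T₁ T₂, e S (T₁ + T₂) = e S T₁ * e S T₂)
  (hgal : ∀ (σ : absoluteGaloisGroup K) (S T : geomTorsion W ((p ^ k * p ^ k : ℕ) : ℤ)), σ • e S T = e (σ • S) (σ • T))
  (halt : ∀ T, e T T = 1) (hnd : ∀ T, (∀ S, e S T = 1) → T = 0)

include hnd in
/-- **Over a TOTALLY COMPLEX number field, at EVERY prime-power level `m = p^k` (`k ≥ 1`, any prime `p`, so `p = 2` included),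
the Cassels–Tate pairing of THE canonical invariant maps on `Ш(E/K)[m]` is a LEVEL pairing, for every elliptic curve `E/K` and
every Weil-type pairing `e` on `E[m²]` — UNCONDITIONALLY**: gk2-p2's `isLevelPairing_ctLevelPairing_canonical_of_isTotallyComplex`
with `hct_alt := ctGeneralFun_self_eq_zero` (Cassels' alternation, this seat). [cite: MilneADT2006, Ch. I §6 Prop. 6.9, Thm. 6.13 (a)]
[cite: Cassels1962ArithmeticIV] -/
theorem isLevelPairing_ctLevelPairing_canonical [IsTotallyComplex K] [NeZero (p ^ k)] [NeZero (p ^ k * p ^ k)] (hk : 0 < k) :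
    Literature.GroupTheory.FiniteAbelian.IsLevelPairing (p ^ k)
      (ctLevelPairing W (p ^ k) e hμ hadd₁ hadd₂ hgal (LocalInvariants.canonical K (p ^ k * p ^ k)) halt
        (sumInvLocalizationEqZero_canonical_of_numberField K (p ^ k * p ^ k))
        (shaThree_mu_eq_zero_of_isTotallyComplex (K := K) (p ^ k * p ^ k))
        (localTerm_finite_support W (p ^ k) e hμ hadd₁ hadd₂ hgal halt (LocalInvariants.canonical K (p ^ k * p ^ k)))) :=
  isLevelPairing_ctLevelPairing_canonical_of_isTotallyComplex W p k e hμ hadd₁ hadd₂ hgal halt hnd hk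
    fun _ ha hma => ctGeneralFun_self_eq_zero halt (LocalInvariants.canonical K (p ^ k * p ^ k))
      (sumInvLocalizationEqZero_canonical_of_numberField K (p ^ k * p ^ k))
      (shaThree_mu_eq_zero_of_isTotallyComplex (K := K) (p ^ k * p ^ k)) ha hma

omit [Fact p.Prime] in
/-- **Existence form**: over a totally complex field a level pairing on `Ш(E/K)[p^k]` exists at every prime power `p^k`, `k ≥ 1`,
for every elliptic curve `E/K` (the hypothesis shape of `WeierstrassCurve.exists_casselsTate_pairing_of_levelwise`), unconditionally —
the Weil pairing on `E[p^{2k}]` is the tree's `exists_weilPairing_holds`. [cite: MilneADT2006, Ch. I §6, Thm. 6.13 (a)]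
[cite: SilvermanAEC2009, Thm. X.4.14] -/
theorem exists_isLevelPairing [IsTotallyComplex K] (hp : p.Prime) (hk : 0 < k) :
    ∃ B : AddSubgroup.torsionBy W.sha (p ^ k) →+ AddSubgroup.torsionBy W.sha (p ^ k) →+ AddCircle (1 : ℚ),
      Literature.GroupTheory.FiniteAbelian.IsLevelPairing (p ^ k) B := by
  haveI : Fact p.Prime := ⟨hp⟩
  haveI : NeZero (p ^ k) := ⟨pow_ne_zero _ hp.ne_zero⟩
  haveI : NeZero (p ^ k * p ^ k) := ⟨mul_ne_zero (NeZero.ne _) (NeZero.ne _)⟩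
  have hpk : 2 ≤ p ^ k := le_trans hp.two_le (Nat.le_self_pow hk.ne' p)
  have h2 : 2 ≤ p ^ k * p ^ k := le_trans hpk (Nat.le_mul_of_pos_right _ (NeZero.pos _))
  have hne : ((p ^ k * p ^ k : ℕ) : K) ≠ 0 := Nat.cast_ne_zero.2 (NeZero.ne _)
  obtain ⟨e, hμ, hadd₁, hadd₂, halt, hnd, hgal⟩ := exists_weilPairing_holds W (p ^ k * p ^ k) h2 hne
  exact ⟨_, isLevelPairing_ctLevelPairing_canonical W p k e hμ hadd₁ hadd₂ hgal halt hnd hk⟩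

end LevelPairing

section Fact

variable {K : Type} [Field K] [NumberField K]

/-- **The Cassels–Tate theorem over a totally complex number field, unconditionally**:
`WeierstrassCurve.exists_casselsTate_pairing (K := K)` — for every elliptic curve `E/K` a pairing on `Ш(E/K)` which is a level
pairing on every `Ш[p^k]` (Milne I Thm. 6.13 / Silverman X.4.14) — from gk2-p2's
`exists_casselsTate_pairing_of_isTotallyComplex_of_alt` with its one displayed input, Cassels' alternation at the `2`-power
levels, DISCHARGED by `ctGeneralFun_self_eq_zero`. [cite: Cassels1962ArithmeticIV] [cite: MilneADT2006, Ch. I §6 Prop. 6.9, Thm. 6.13 (a)(b)]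
[cite: MorganSmith2021CTP, §5 Thm. 5.10] -/
theorem exists_casselsTate_pairing_of_isTotallyComplex [IsTotallyComplex K] :
    WeierstrassCurve.exists_casselsTate_pairing (K := K) :=
  exists_casselsTate_pairing_of_isTotallyComplex_of_alt fun W _ k _ _ _ e hμ hadd₁ hadd₂ hgal halt _ _ ha hma =>
    ctGeneralFun_self_eq_zero (W := W) (e := e) (hμ := hμ) (hadd₁ := hadd₁) (hadd₂ := hadd₂) (hgal := hgal) halt
      (LocalInvariants.canonical K (2 ^ k * 2 ^ k)) (sumInvLocalizationEqZero_canonical_of_numberField K (2 ^ k * 2 ^ k))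
      (shaThree_mu_eq_zero_of_isTotallyComplex (K := K) (2 ^ k * 2 ^ k)) ha hma

end Fact

end Summit.BirchSwinnertonDyer.BirchSwinnertonDyer.Theorems.GenusExact.CasselsTateTotallyComplex

end
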